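/-
Copyright (c) 2026 the pub-hodgecm-mathlib formalisation cell (harness21).  Prover seat hodgecm-mathlib-K2E3-p17 (g11), HCML Track B «K2-LIT» ∕ h413
(`stmt-HodgeConjecture-24833`), R90-TF section S3, (U3-F) brick P4 «irreducible over ℚ from irreducible mod ℓ; irreducible monic polynomials of every
degree over a finite field; monic ℤ-lifts» (OPEN OFFER of the S3 dealer R90-C12-plan (g2) 2026-09-05T00:09:49Z, memo
`R90/R90-C12-plan/g2/DEAL-S3-U3F-SPLIT.v1.md` §1 row P4; taken by name 00:15Z).  2026-09-05.
-/
import Mathlib.Algebra.Polynomial.Eval.Irreducible      -- `Polynomial.Monic.irreducible_of_irreducible_map`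
import Mathlib.RingTheory.Polynomial.GaussLemma         -- `Polynomial.Monic.irreducible_iff_irreducible_map_fraction_map`
import Mathlib.RingTheory.Polynomial.RationalRoot       -- `UniqueFactorizationMonoid.instIsIntegrallyClosed` (so `IsIntegrallyClosed ℤ`)
import Mathlib.Algebra.Polynomial.Lifts                 -- `Polynomial.lifts_and_natDegree_eq_and_monic`
import Mathlib.FieldTheory.Finite.Extension             -- `FiniteField.Extension k p n`, `FiniteField.finrank_extension`
import Mathlib.FieldTheory.PrimitiveElement             -- `Field.exists_primitive_element`
import Mathlib.Data.ZMod.Basic                          -- `ZMod.ringHom_surjective`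
import HarnessLib

/-!
# R90-TF · S3 · THEOREMS — `R90S3IrreducibleOfIrreducibleMod` ((U3-F) brick P4): a monic integer polynomial that is irreducible modulo a prime is
# irreducible over `ℚ`; over every finite field there are monic irreducible polynomials of every positive degree; monic lifts to `ℤ[X]`

R90-TF section S3 (dealer R90-C12-plan (g2), planner split `DEAL-S3-U3F-SPLIT.v1.md` §1 row P4 = census F-a3 of K2E3-p17 (g10)
`R90/S3/CENSUS-U3-globalise.K2E3-p17-g10.md`); crux H413 (`stmt-HodgeConjecture-24833`, lane `--supports … --as helper`), route `HCCMUnconditional`.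
Serves step F-a («planted field `F′ = ℚ(α)`, `f = minpoly α ∈ ℤ[X]` monic of degree `d`») of the ℚ-PLANTED road behind the socket
`stub_R90_S3_auxGlobaliseField` (`Cruxes/H413/Lines/R90_S3_LocalTransportWaveG.lean` :645): the CRT step P3 (`PlantedPolynomial`) chooses the monic `f ∈ ℤ[X]`
congruent modulo one auxiliary prime `ℓ` to a monic IRREDUCIBLE `g ∈ 𝔽_ℓ[X]` of degree `d`; this file supplies (i) the existence of such a `g` for every `ℓ`
and every `d ≥ 1`, (ii) the conclusion «`f` is irreducible over `ℤ` and over `ℚ`», and (iii) monic integer lifts of prescribed degree (non-emptiness of the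
congruence class).  PURE MATHLIB (Gauss's lemma, finite fields, primitive elements); THEOREMS ONLY (no `def`, no `instance`, no notation, no named fact, no
`sorry`); never imports `Cruxes/…/Lines`.

THE MATHEMATICS [folklore].  (i) If `f ∈ ℤ[X]` is monic and its image in `S[X]` under a ring map `ℤ → S` to an integral domain is irreducible, then `f` is
irreducible in `ℤ[X]` (a factorisation `f = a b` maps to a factorisation with `deg ā + deg b̄ = deg f`, monicity pins the leading coefficients — Mathlib
`Polynomial.Monic.irreducible_of_irreducible_map`), hence irreducible in `ℚ[X]` by GAUSS'S LEMMA (Mathlib `Polynomial.Monic.irreducible_iff_irreducible_map_fraction_map`).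
(ii) A finite field `k` of characteristic `p` has an extension `E` of every degree `n ≥ 1` (Mathlib `FiniteField.Extension k p n`, `finrank_extension`);
`E∕k` is separable, so `E = k(α)` for a primitive element `α` (Mathlib `Field.exists_primitive_element`), and `minpoly_k α` is monic irreducible of degree
`[k(α) : k] = n`.  (iii) `ℤ → ℤ∕ℓ` is surjective, so every monic `g ∈ (ℤ∕ℓ)[X]` lifts to a monic `f ∈ ℤ[X]` of the same degree (Mathlib
`Polynomial.lifts_and_natDegree_eq_and_monic`).
* §1 `irreducible_of_monic_of_irreducible_map`, **`irreducible_map_rat_of_monic_of_irreducible_map`** (any integral domain `S`), `…_algebraMap` spelling,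
  and the mod-`ℓ` specialisations `irreducible_of_irreducible_mod`, **`irreducible_map_rat_of_irreducible_mod`**.
* §2 **`exists_monic_irreducible_natDegree_eq`** (any finite field), `exists_monic_irreducible_natDegree_eq_zmod`.
* §3 `exists_monic_lift_of_monic_zmod` (monic lift of the same `natDegree`).
* §4 the package for P3∕P8: **`exists_monic_irreducible_mod_natDegree_eq`** — for every prime `ℓ` and `n ≥ 1` a monic `f ∈ ℤ[X]` of `natDegree n` that is
  irreducible mod `ℓ`, irreducible over `ℤ` and irreducible over `ℚ`; and `irreducible_map_rat_of_map_zmod_eq` (any monic `f` congruent to an irreducible `g`).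

HONEST LABEL: HC_CM is proved only modulo the 7 printed citations (2 remaining named inputs: hLiu418 = stmt-HodgeConjecture-24832, h413 =
stmt-HodgeConjecture-24833) until rung 0 closes; elementary algebra for a sub-step of a GENUINE residual ((U3-F)); proves nothing printed; count-neutral.

## References
* [Rogawski1990] J. D. Rogawski, *Automorphic Representations of Unitary Groups in Three Variables*, Ann. of Math. Stud. 123 (1990), §13.8 p. 216 (context:
  the auxiliary global field of the globalisation argument).
* [CasselsFrohlichANT1967] J. W. S. Cassels, A. Fröhlich (eds.), *Algebraic Number Theory* (1967), Ch. II §6 (weak approximation ∕ CRT — the consumer P3).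
-/

set_option autoImplicit false
-- the mandated namespace repeats the single-problem summit's segment (`HodgeConjecture.HodgeConjecture`)
set_option linter.dupNamespace false

noncomputable section

namespace Summit.HodgeConjecture.HodgeConjecture.R90.S3

open Polynomial

/-! ## §1 Irreducibility over `ℤ` and over `ℚ` from irreducibility of the image in an integral domain (e.g. modulo a prime) -/

/-- **Monic + irreducible image ⇒ irreducible over `ℤ`.**  If `f ∈ ℤ[X]` is monic and `f.map φ` is irreducible for a ring map `φ : ℤ →+* S` to an
integral domain `S`, then `f` is irreducible in `ℤ[X]` (Mathlib `Polynomial.Monic.irreducible_of_irreducible_map`). [folklore] -/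
theorem irreducible_of_monic_of_irreducible_map {S : Type*} [CommRing S] [IsDomain S] (φ : ℤ →+* S) {f : ℤ[X]} (hf : f.Monic)
    (h : Irreducible (f.map φ)) : Irreducible f :=
  Monic.irreducible_of_irreducible_map φ f hf h

/-- **Monic + irreducible image ⇒ irreducible over `ℚ`** (`algebraMap` spelling): GAUSS'S LEMMA (Mathlib
`Polynomial.Monic.irreducible_iff_irreducible_map_fraction_map`) on top of `irreducible_of_monic_of_irreducible_map`. [folklore] -/
theorem irreducible_map_algebraMap_rat_of_monic_of_irreducible_map {S : Type*} [CommRing S] [IsDomain S] (φ : ℤ →+* S) {f : ℤ[X]} (hf : f.Monic)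
    (h : Irreducible (f.map φ)) : Irreducible (f.map (algebraMap ℤ ℚ)) :=
  (hf.irreducible_iff_irreducible_map_fraction_map (K := ℚ)).1 (irreducible_of_monic_of_irreducible_map φ hf h)

/-- **Monic + irreducible image ⇒ irreducible over `ℚ`** (`Int.castRingHom` spelling). [folklore] -/
theorem irreducible_map_rat_of_monic_of_irreducible_map {S : Type*} [CommRing S] [IsDomain S] (φ : ℤ →+* S) {f : ℤ[X]} (hf : f.Monic)
    (h : Irreducible (f.map φ)) : Irreducible (f.map (Int.castRingHom ℚ)) := by
  rw [← algebraMap_int_eq]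
  exact irreducible_map_algebraMap_rat_of_monic_of_irreducible_map φ hf h

/-- **Irreducible mod `ℓ` ⇒ irreducible over `ℤ`** (monic `f`, `ℓ` prime). [folklore] -/
theorem irreducible_of_irreducible_mod {ℓ : ℕ} [Fact ℓ.Prime] {f : ℤ[X]} (hf : f.Monic)
    (h : Irreducible (f.map (Int.castRingHom (ZMod ℓ)))) : Irreducible f :=
  irreducible_of_monic_of_irreducible_map (Int.castRingHom (ZMod ℓ)) hf h

/-- **Irreducible mod `ℓ` ⇒ irreducible over `ℚ`** (monic `f`, `ℓ` prime; `Int.castRingHom` spelling). [folklore] -/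
theorem irreducible_map_rat_of_irreducible_mod {ℓ : ℕ} [Fact ℓ.Prime] {f : ℤ[X]} (hf : f.Monic)
    (h : Irreducible (f.map (Int.castRingHom (ZMod ℓ)))) : Irreducible (f.map (Int.castRingHom ℚ)) :=
  irreducible_map_rat_of_monic_of_irreducible_map (Int.castRingHom (ZMod ℓ)) hf h

/-- **Irreducible mod `ℓ` ⇒ irreducible over `ℚ`** (monic `f`, `ℓ` prime; `algebraMap` spelling). [folklore] -/
theorem irreducible_map_algebraMap_rat_of_irreducible_mod {ℓ : ℕ} [Fact ℓ.Prime] {f : ℤ[X]} (hf : f.Monic)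
    (h : Irreducible (f.map (Int.castRingHom (ZMod ℓ)))) : Irreducible (f.map (algebraMap ℤ ℚ)) :=
  irreducible_map_algebraMap_rat_of_monic_of_irreducible_map (Int.castRingHom (ZMod ℓ)) hf h

/-! ## §2 Monic irreducible polynomials of every positive degree over a finite field -/

/-- **Irreducible polynomials of every degree over a finite field.**  For a finite field `k` and `n ≥ 1` there is a monic irreducible `g ∈ k[X]` with
`natDegree g = n`: the minimal polynomial of a primitive element of the degree-`n` extension `FiniteField.Extension k p n`. [folklore] -/
theorem exists_monic_irreducible_natDegree_eq (k : Type*) [Field k] [Finite k] (n : ℕ) (hn : n ≠ 0) :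
    ∃ g : k[X], g.Monic ∧ Irreducible g ∧ g.natDegree = n := by
  obtain ⟨p, hp⟩ := CharP.exists k
  haveI : Fact p.Prime := ⟨CharP.char_is_prime k p⟩
  haveI : NeZero n := ⟨hn⟩
  -- the degree-`n` extension `E ∕ k` and a primitive element `α`, `k⟮α⟯ = ⊤`
  obtain ⟨α, hα⟩ := Field.exists_primitive_element k (FiniteField.Extension k p n)
  have hint : IsIntegral k α := Algebra.IsIntegral.isIntegral α
  refine ⟨minpoly k α, minpoly.monic hint, minpoly.irreducible hint, ?_⟩
  -- `natDegree (minpoly k α) = [k⟮α⟯ : k] = [E : k] = n`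
  rw [← IntermediateField.adjoin.finrank hint, hα, IntermediateField.finrank_top', FiniteField.finrank_extension]

/-- **Irreducible polynomials of every degree over `ℤ∕ℓ`** (`ℓ` prime, `n ≥ 1`). [folklore] -/
theorem exists_monic_irreducible_natDegree_eq_zmod (ℓ : ℕ) [Fact ℓ.Prime] (n : ℕ) (hn : n ≠ 0) :
    ∃ g : (ZMod ℓ)[X], g.Monic ∧ Irreducible g ∧ g.natDegree = n :=
  exists_monic_irreducible_natDegree_eq (ZMod ℓ) n hn

/-! ## §3 Monic integer lifts of prescribed degree -/

/-- **Monic lift.**  Every monic `g ∈ (ℤ∕ℓ)[X]` (any `ℓ`) is the reduction of a monic `f ∈ ℤ[X]` with the same `natDegree` (Mathlib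
`Polynomial.lifts_and_natDegree_eq_and_monic`, `ZMod.ringHom_surjective`). [folklore] -/
theorem exists_monic_lift_of_monic_zmod {ℓ : ℕ} (g : (ZMod ℓ)[X]) (hg : g.Monic) :
    ∃ f : ℤ[X], f.map (Int.castRingHom (ZMod ℓ)) = g ∧ f.natDegree = g.natDegree ∧ f.Monic :=
  lifts_and_natDegree_eq_and_monic (mem_lifts_of_surjective (ZMod.ringHom_surjective (Int.castRingHom (ZMod ℓ))) g) hg

/-! ## §4 The package used by the planted-polynomial step (P3) and the assembly (P8) -/

/-- **Congruent to an irreducible ⇒ irreducible over `ℚ`.**  If `f ∈ ℤ[X]` is monic and reduces modulo the prime `ℓ` to an irreducible `g`, then `f` is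
irreducible over `ℤ` and `f.map (Int.castRingHom ℚ)` is irreducible (the form the CRT step instantiates: it produces `f` with `f mod ℓ = g`). [folklore] -/
theorem irreducible_map_rat_of_map_zmod_eq {ℓ : ℕ} [Fact ℓ.Prime] {f : ℤ[X]} (hf : f.Monic) {g : (ZMod ℓ)[X]} (hg : Irreducible g)
    (hfg : f.map (Int.castRingHom (ZMod ℓ)) = g) : Irreducible f ∧ Irreducible (f.map (Int.castRingHom ℚ)) :=
  ⟨irreducible_of_irreducible_mod hf (hfg ▸ hg), irreducible_map_rat_of_irreducible_mod hf (hfg ▸ hg)⟩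

/-- **Monic integer polynomials of every degree, irreducible modulo a given prime.**  For every prime `ℓ` and every `n ≥ 1` there is a monic `f ∈ ℤ[X]`
with `natDegree f = n` whose reduction mod `ℓ` is irreducible; consequently `f` is irreducible over `ℤ` and over `ℚ`. [folklore] -/
theorem exists_monic_irreducible_mod_natDegree_eq (ℓ : ℕ) [Fact ℓ.Prime] (n : ℕ) (hn : n ≠ 0) :
    ∃ f : ℤ[X], f.Monic ∧ f.natDegree = n ∧ Irreducible (f.map (Int.castRingHom (ZMod ℓ))) ∧ Irreducible f ∧
      Irreducible (f.map (Int.castRingHom ℚ)) := by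
  obtain ⟨g, hgm, hgi, hgn⟩ := exists_monic_irreducible_natDegree_eq_zmod ℓ n hn
  obtain ⟨f, hfg, hfn, hfm⟩ := exists_monic_lift_of_monic_zmod g hgm
  have hirr : Irreducible (f.map (Int.castRingHom (ZMod ℓ))) := hfg ▸ hgi
  exact ⟨f, hfm, hfn.trans hgn, hirr, irreducible_of_irreducible_mod hfm hirr, irreducible_map_rat_of_irreducible_mod hfm hirr⟩

/-- **Degree-`n` number-field generator, `ℚ[X]` form.**  For every `n ≥ 1` there is a monic irreducible `q ∈ ℚ[X]` of `natDegree n` with integer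
coefficients (i.e. `q = f.map (Int.castRingHom ℚ)` for a monic `f ∈ ℤ[X]`), irreducible modulo the prescribed prime `ℓ`. [folklore] -/
theorem exists_monic_irreducible_rat_natDegree_eq (ℓ : ℕ) [Fact ℓ.Prime] (n : ℕ) (hn : n ≠ 0) :
    ∃ f : ℤ[X], f.Monic ∧ f.natDegree = n ∧ Irreducible (f.map (Int.castRingHom (ZMod ℓ))) ∧
      (f.map (Int.castRingHom ℚ)).Monic ∧ (f.map (Int.castRingHom ℚ)).natDegree = n ∧ Irreducible (f.map (Int.castRingHom ℚ)) := by
  obtain ⟨f, hfm, hfn, hirr, -, hirrQ⟩ := exists_monic_irreducible_mod_natDegree_eq ℓ n hn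
  exact ⟨f, hfm, hfn, hirr, hfm.map _, by rw [hfm.natDegree_map]; exact hfn, hirrQ⟩

end Summit.HodgeConjecture.HodgeConjecture.R90.S3

end
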